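import Literature.MathematicalPhysics.QuantumFieldTheory.Balaban1983to89.B9Thm39CinvSandwichQ
import Literature.MathematicalPhysics.QuantumFieldTheory.Balaban1983to89.B9Thm39CinvUpperL

/-!
# `Balaban1983to89.B9Thm39CinvUpperLMember` — [Balaban1985BackgroundPropagators] (3.95) p. 411 / [Balaban1984PropagatorsII] (2.83) p. 237: THE UPPER MAJORANT OF
# `L = Q′G′²Q′*(U)` ON def-Y's BLOCK CARRIER FROM THEOREM 3.1's (3.42) BLOCK OF `G′(U)` OVER THE INVARIANT CLASS — the M5.5 ⟶ M5.6 junction BY NAME: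
# `EBlock (kernelFamilySInv … G′ …)` (M5.5's output) ⇒ READ (D1) ⇒ the weighted product (FILE 3a) ⇒ the `Q′( · )Q′*` sandwich (FILE 3b) = FILE 2's / FILE 6's
# displayed `hL`, `hGG` (cell `lit-balaban`, G-B9-LETTERS module M5.6 FILE 7, seat p21 gen 32)

statement-level skeleton of published theorems with citation tags; proofs where landed; nothing here is a claim about the Yang–Mills mass gap

CITATION HEADER (lean-in-tree rule).  B9 = T. Bałaban, *Propagators for lattice gauge theories in a background field*, Commun. Math. Phys. **99** (1985)
389–434 (journal page = PDF page + 388).  p. 397 Theorem 3.1 (3.42)₁ «|(G′(U)λ)(x)| ≦ B₀(Lʲη)²e^{−δ₀d(y,y′)}|λ| for x ∈ Δ(y), y ∈ Λ_j, supp λ ⊂ Δ(y′)»; p. 411 (3.95)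
(the letter `Q′G′²Q′*` of the three sums, «By the same estimates as in [4], especially (2.83)–(2.85)»); p. 398 «Using Lemma 2.1 in [4] we may replace the factor
(Lʲη)^α by (Lʲη)^β(L^{j′}η)^γ with β + γ = α» (scale transfer).  [4] = [Balaban1984PropagatorsII] T. Bałaban, *Propagators and renormalization transformations
for lattice gauge theories. II*, Commun. Math. Phys. **96** (1984) 223–250: (2.83) p. 237 «O(1)(Lʲη)⁴e^{−½δ₀d(y,y″)}» (the kernel factor of `Q′G′²Q′*`), (2.51)–(2.52)
p. 232, (2.60)–(2.61) p. 234.  Rows B9.Eq3.95 × B9.Thm3.1 × B4.Eq2.83 (cells only; no row head changes).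

WHY THIS FILE.  M5.5 (`B9Thm37GpTorusRegularFinal.eBlock_kernelFamilySInv_Gp_of_localInverse`) delivers Theorem 3.1's (3.42) for `G′(U)` at a general regular `U`
as the block `EBlock (kernelFamilySInv i B cfg G′ parS) B_G δ_G U₁` over the gauge-invariant test class.  M5.6 FILE 6 (`hasMajorant_conj_XinvY_final`) takes
the SITE majorant `hGG` of `conj b (s′•(G′·G′))` (and FILE 2 the block majorant `hL` of `conj b (s′•Q′G′²Q′*)`).  THIS FILE is the two-line junction: D1's
READ lemma `B9CubeLettersInvReadDict.hasMajorant_conj_G_of_eBlockInv` (EBlock ⇒ majorant `M₂Σ‖b_j‖·B_G·ℓ(a)²·e^{−δ_Gd}` of `conj b (η²G′)`), FILE 3a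
`hasMajorant_conj_mul_weighted` (the product `η⁴G′²`: `(M₂Σ‖b_j‖B_G)²Cc₁·ℓ(a)⁴·e^{−(1−α′)(1−α_st)δ_Gd}`), FILE 3b `hasMajorant_conj_XY_of_site` (the sandwich).

WHAT IS PROVED (all `theorem`s, 0 `def`, 0 sorry, 0 new named facts).
* ★★ `hasMajorant_conj_GG_of_eBlockInv` — FILE 6's `hGG` (resp. `hGGc` for a cube letter) from `EBlock (kernelFamilySInv i B cfg O parS) B_G δ_G U₁`, a section
  `ιB` of `β`, a coordinate bound `M₂` of `b`, the scale transfer of `ℓ²` at exponent `α_st`, [4] Lemma 2.1 (2.61) at `((1−α_st)δ_G, α′)`, (2.54), `d ≧ 0`, and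
  any target rate `a_Lδ₀ ≦ (1−α′)(1−α_st)δ_G`: `conj b ((η²η²)•(O·O)) ≺ ((M₂Σ‖b_j‖B_G)²Cc₁)·((ℓ(a)⁴)⁻¹)⁻¹·e^{−a_Lδ₀d}` (weight written as FILE 6 reads it with
  `P := ℓ⁻⁴`).
* ★★ `hasMajorant_conj_XY_of_eBlockInv` — FILE 2's `hL`: the same for `conj b ((η²η²)•XY i parS O U)` with the extra factor `(M₂Σ‖b_j‖)²` (contractive transporters).

HONEST SCOPE.  Composition of landed lemmas; the (3.42) block `hE`, the scale transfer (M5.5 FILE 1 `geo_inputs_geo9K` / `B9RWSums346Schur.scaleTransfer_len_rpow`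
shapes) and (2.61) are displayed hypotheses; corner-free members only (the section `ιB`, D1/def-Y READ-8); nothing of Theorem 3.1 asserted; NOT summit progress.
RELATED, NOT DUPLICATED: D1 `hasMajorant_conj_G_of_eBlockInv` (one factor), FILE 3a (generic product), FILE 3b (generic sandwich) — USED BY NAME; searched
2026-08-28 `lean search 'conj_GG_of_eBlock|XY_of_eBlock' --decl` = ∅.
-/

noncomputable section

namespace Literature.MathematicalPhysics.QuantumFieldTheory.Balaban1983to89.B9Thm39CinvUpperLMember

open Node00 B9CubeLettersInvReadings
open B6Geom246MultiLevelBox (blkOf)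
open B6Ineq2142KLevelV1 (β)
open B6KLevelCensusIndexV1 (KIdx)
open B6RandomWalk (HasMajorant Triangle254 Ineq261 hasMajorant_mono)
open B9Thm34Ext (toB6)
open B9FromB6 (EBlock)
open B9GeoNormsKLevelV1 (geo9K)
open B9Eq352DivFormLetters (conj)
open B9CubeLettersInvReadDict (hasMajorant_conj_G_of_eBlockInv)
open B9Thm39CinvUpperL (hasMajorant_conj_mul_weighted)
open B9Thm39CinvSandwichQ (hasMajorant_conj_XY_of_site)

variable {d ℓ : ℕ} {hd : 1 ≤ d + 1} {hL : Odd (ℓ + 1) ∧ 1 < ℓ + 1} {b₀ b₁ : ℝ}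
variable {𝔸 : Type} [NormedRing 𝔸] [NormedAlgebra ℂ 𝔸] [CompleteSpace 𝔸]
variable {ι : Type} [Fintype ι] [DecidableEq ι]
variable (i : KIdx d ℓ hd hL b₀ b₁) (b : Module.Basis ι ℝ 𝔸)
variable [Fintype (geo9K i).Site] [DecidableEq (geo9K i).Site] {Rr : ℝ} {Hp : Prop}
variable {B : B9.Backgrounds} (cfg : B.Cfg → CfgY 𝔸 i) (O : SiteOpY 𝔸 i) (parS : SiteParY 𝔸 i) {U₁ : B.Cfg}

omit [DecidableEq ι] [DecidableEq (geo9K i).Site] in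
/-- ★★ **THE SITE MAJORANT OF `conj b (η⁴•(G′·G′))` FROM THEOREM 3.1's (3.42) BLOCK OVER THE CLASS** (FILE 6's `hGG`; [4] (2.83): the factor «O(1)(Lʲη)⁴e^{−½δ₀d}»
of `G′²` with O(1) and the rate explicit): `EBlock (kernelFamilySInv i B cfg O parS) B_G δ_G U₁` ⟹ for every target rate `a_Lδ₀ ≦ (1−α′)(1−α_st)δ_G`,
`conj b ((η²η²)•(O(U)·O(U))) ≺ ((M₂Σ_j‖b_j‖B_G)²·C·c₁((1−α_st)δ_G, α′))·((ℓ(a)⁴)⁻¹)⁻¹·e^{−a_Lδ₀d(a,a″)}` on def-Y's site carrier (block map `(z,j) ↦ ιB(Δ(z))`).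
[cite: Balaban1985BackgroundPropagators, Thm 3.1 (3.42) p.397 + (3.95) p.411 + p.398 (scale transfer); Balaban1984PropagatorsII, (2.83) p.237 + (2.52) p.232 + (2.61) p.234] -/
theorem hasMajorant_conj_GG_of_eBlockInv {BG δG : ℝ} (hE : EBlock (kernelFamilySInv i B cfg O parS) BG δG U₁) (hBG : 0 ≤ BG)
    (ιB : BlkY i → IBondY i) (hι : ∀ s, β i.hN i.D i.hk (ιB s) = s)
    {M₂ : ℝ} (hM₂ : 0 ≤ M₂) (hrepr : ∀ (v : 𝔸) (j : ι), |b.repr v j| ≤ M₂ * ‖v‖)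
    (d' : ℕ) {αst α' C aL δ₀ : ℝ} (hC : 0 ≤ C) (hαδ : 0 ≤ αst * δG) (hα'0 : 0 ≤ α') (hα'1 : α' ≤ 1) (hδ' : 0 ≤ (1 - αst) * δG)
    (htri : Triangle254 (toB6 (geo9K i) Rr Hp)) (hdnn : ∀ a a' : (geo9K i).Site, 0 ≤ (geo9K i).dist a a')
    (hST : B9Ineq347.ScaleTransfer (geo9K i) δG αst C (fun a => (geo9K i).len a ^ 2))
    (h261 : Ineq261 d' (toB6 (geo9K i) Rr Hp) ((1 - αst) * δG) α')
    (hrate : aL * δ₀ ≤ (1 - α') * ((1 - αst) * δG)) :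
    HasMajorant (g := toB6 (geo9K i) Rr Hp) (fun p : SiteY i × ι => ιB (blkOf i.D.toDomains p.1))
      (conj b ((etaS i ^ 2 * etaS i ^ 2) • ((O (cfg U₁)).restrictScalars ℝ * (O (cfg U₁)).restrictScalars ℝ)))
      (fun a a'' => ((M₂ * (∑ j, ‖b j‖) * BG) ^ 2 * C * B6.c1 d' ((1 - αst) * δG) α') * (((geo9K i).len a ^ 4)⁻¹)⁻¹ *
        Real.exp (-(aL * δ₀ * (geo9K i).dist a a''))) := by
  -- (3.42)₁ READ: the majorant of `conj b (η²G′)` (D1)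
  have hG := hasMajorant_conj_G_of_eBlockInv i b cfg O parS (Rr := Rr) (Hp := Hp) hE hBG ιB hι hM₂ hrepr rfl
    ((etaS i ^ 2) • (O (cfg U₁)).restrictScalars ℝ) (fun _ => rfl)
  -- the weighted product (FILE 3a)
  have hGG := hasMajorant_conj_mul_weighted b (g := geo9K i) (R := Rr) (H := Hp) (fun p : SiteY i × ι => ιB (blkOf i.D.toDomains p.1)) d'
    (fun a => (geo9K i).len a ^ 2) (fun a => (geo9K i).len a ^ 2) (etaS i ^ 2) (etaS i ^ 2)
    (B₁ := M₂ * (∑ j, ‖b j‖) * BG) (B₂ := M₂ * (∑ j, ‖b j‖) * BG)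
    (mul_nonneg (mul_nonneg hM₂ (Finset.sum_nonneg fun j _ => norm_nonneg (b j))) hBG)
    (mul_nonneg (mul_nonneg hM₂ (Finset.sum_nonneg fun j _ => norm_nonneg (b j))) hBG) hC (fun a => sq_nonneg _) (fun a => sq_nonneg _)
    hαδ hα'0 hα'1 hδ' htri hdnn hST h261 hG hG
  refine hasMajorant_mono (g := toB6 (geo9K i) Rr Hp) _ hGG fun a a'' => ?_
  have hpre : 0 ≤ (M₂ * (∑ j, ‖b j‖) * BG) ^ 2 * C * B6.c1 d' ((1 - αst) * δG) α' * (((geo9K i).len a ^ 4)⁻¹)⁻¹ := by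
    rw [inv_inv]
    exact mul_nonneg (mul_nonneg (mul_nonneg (sq_nonneg _) hC) (B6RandomWalk.c1_nonneg d' _ _)) (pow_nonneg (B6KLevelCensusIndexV1.len_pos i a).le 4)
  have hexp : Real.exp (-((1 - α') * ((1 - αst) * δG) * (geo9K i).dist a a'')) ≤ Real.exp (-(aL * δ₀ * (geo9K i).dist a a'')) := by
    refine Real.exp_le_exp.mpr ?_
    have h1 := mul_le_mul_of_nonneg_right hrate (hdnn a a'')
    linarith
  calc M₂ * (∑ j, ‖b j‖) * BG * (M₂ * (∑ j, ‖b j‖) * BG) * C * B6.c1 d' ((1 - αst) * δG) α' *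
        ((geo9K i).len a ^ 2 * (geo9K i).len a ^ 2) * Real.exp (-((1 - α') * ((1 - αst) * δG) * (geo9K i).dist a a''))
      = (M₂ * (∑ j, ‖b j‖) * BG) ^ 2 * C * B6.c1 d' ((1 - αst) * δG) α' * (((geo9K i).len a ^ 4)⁻¹)⁻¹ *
          Real.exp (-((1 - α') * ((1 - αst) * δG) * (geo9K i).dist a a'')) := by rw [inv_inv]; ring
    _ ≤ _ := mul_le_mul_of_nonneg_left hexp hpre

omit [DecidableEq ι] in
/-- ★★ **THE BLOCK MAJORANT OF `conj b (η⁴•Q′G′²Q′*(U))` FROM THEOREM 3.1's (3.42) BLOCK** (FILE 2's displayed `hL`; [4] (2.83) line 1 «O(1)(Lʲη)⁴e^{−½δ₀d(y,y″)}»):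
`hasMajorant_conj_GG_of_eBlockInv` through the `Q′( · )Q′*` sandwich of FILE 3b (contractive transporters): majorant
`((M₂Σ_j‖b_j‖)²·(M₂Σ_j‖b_j‖B_G)²·C·c₁)·((ℓ(a)⁴)⁻¹)⁻¹·e^{−a_Lδ₀d}` on def-Y's block carrier (block map `(s,j) ↦ ιB s`).
[cite: Balaban1985BackgroundPropagators, (3.95) p.411 + (3.21)/(3.25) pp.394–395 + Thm 3.1 (3.42) p.397; Balaban1984PropagatorsII, (2.83) p.237] -/
theorem hasMajorant_conj_XY_of_eBlockInv {BG δG : ℝ} (hE : EBlock (kernelFamilySInv i B cfg O parS) BG δG U₁) (hBG : 0 ≤ BG)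
    (ιB : BlkY i → IBondY i) (hι : ∀ s, β i.hN i.D i.hk (ιB s) = s)
    (hpar : ∀ z w : SiteY i, ‖(parS (cfg U₁) z w : 𝔸)‖ ≤ 1 ∧ ‖(((parS (cfg U₁) z w)⁻¹ : 𝔸ˣ) : 𝔸)‖ ≤ 1)
    {M₂ : ℝ} (hM₂ : 0 ≤ M₂) (hrepr : ∀ (v : 𝔸) (j : ι), |b.repr v j| ≤ M₂ * ‖v‖)
    (d' : ℕ) {αst α' C aL δ₀ : ℝ} (hC : 0 ≤ C) (hαδ : 0 ≤ αst * δG) (hα'0 : 0 ≤ α') (hα'1 : α' ≤ 1) (hδ' : 0 ≤ (1 - αst) * δG)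
    (htri : Triangle254 (toB6 (geo9K i) Rr Hp)) (hdnn : ∀ a a' : (geo9K i).Site, 0 ≤ (geo9K i).dist a a')
    (hST : B9Ineq347.ScaleTransfer (geo9K i) δG αst C (fun a => (geo9K i).len a ^ 2))
    (h261 : Ineq261 d' (toB6 (geo9K i) Rr Hp) ((1 - αst) * δG) α')
    (hrate : aL * δ₀ ≤ (1 - α') * ((1 - αst) * δG)) :
    HasMajorant (g := toB6 (geo9K i) Rr Hp) (fun q : BlkY i × ι => ιB q.1)
      (conj b ((etaS i ^ 2 * etaS i ^ 2) • (XY i parS O (cfg U₁)).restrictScalars ℝ))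
      (fun a a'' => (M₂ * ∑ j, ‖b j‖) ^ 2 * (((M₂ * (∑ j, ‖b j‖) * BG) ^ 2 * C * B6.c1 d' ((1 - αst) * δG) α') *
        (((geo9K i).len a ^ 4)⁻¹)⁻¹ * Real.exp (-(aL * δ₀ * (geo9K i).dist a a'')))) :=
  hasMajorant_conj_XY_of_site i b ιB parS O (cfg U₁) hpar hM₂ hrepr (etaS i ^ 2 * etaS i ^ 2)
    (fun a a'' => by
      rw [inv_inv]
      exact mul_nonneg (mul_nonneg (mul_nonneg (mul_nonneg (sq_nonneg _) hC) (B6RandomWalk.c1_nonneg d' _ _))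
        (pow_nonneg (B6KLevelCensusIndexV1.len_pos i a).le 4)) (Real.exp_nonneg _))
    (hasMajorant_conj_GG_of_eBlockInv i b cfg O parS hE hBG ιB hι hM₂ hrepr d' hC hαδ hα'0 hα'1 hδ' htri hdnn hST h261 hrate)

end Literature.MathematicalPhysics.QuantumFieldTheory.Balaban1983to89.B9Thm39CinvUpperLMember

end
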